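import Summits.QuantumFields.YangMills.Theorems.LuscherReductionTwistedTraceScalingSlowDisintegration
import Summits.QuantumFields.YangMills.Theorems.LuscherReductionTwistedTraceScalingConstTubeOrtho
import HarnessLib

/-!
# EXACT one-site disintegration on the two constant-mode tubes (gnomonic and orthographic): `∫_tube F dσ^{⊗E} = ∫ (∫ F(chart u y) dσ^{⊗3}(u)) dπ(y)`
# (lane A of S-BASE, crux `TwistedTraceScaling` stmt-QuantumFields-20203, sub-target C4 INNER; design note `pub/ym-fleet/ym-luscher-20007-p1/COARSE-DESIGN.md` §23)

Instances of the abstract theorem `SlowChart.integral_configMeasure_slowChart` (`…SlowDisintegration`: any continuous injective EQUIVARIANT chart on a Polish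
parameter space carries the product measure `σ^{⊗3} ⊗ π` exactly) for the two charts of `…ConstTube` / `…ConstTubeOrtho`:
* gnomonic: `constTube L` (range of `tubeMap` on balanced coordinates) is measurable, and ★★★ `integral_configMeasure_tube`:
  `∫ F dσ^{⊗E} = ∫ (∫ F(tubeMap L u y) dσ^{⊗3}(u)) d(tubeTransverse L)(y)` for bounded measurable `F` vanishing off `constTube L`; `tubeTransverse L` is a finite
  measure on `Edge → ℝ³` carried by `balancedSet L`;
* orthographic: `orthoTubeSet L` is measurable, and ★★★ `integral_configMeasure_orthoTube`: the same with `orthoTube`, `orthoTransverse L` carried by `capBalancedSet L`.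
So on either tube the SLOW variable `u` of the Born–Oppenheimer chart is integrated against the ONE-SITE a-priori measure `configMeasure SU2 1` — the measure of the
one-site kernel `transferKernel_constLift` and of the one-site levels `levelValue su2Rep 1 (L³β) k` — with NO Jacobian.
HONEST FRAMING: exact measure bookkeeping for a stub of a child of the CONDITIONAL reduction route R2b1; no kernel estimate; C4 OPEN; not a gap, not Clay.
-/

set_option autoImplicit false

noncomputable section

open MeasureTheory Filter Topology Real
open scoped BigOperators
open Literature.MathematicalPhysics.QuantumFieldTheory
open Literature.MathematicalPhysics.QuantumLattice

namespace Summit.QuantumFields.YangMills.Theorems.FemtoTransferGap.TwoLattice.ConstTube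

open Summit.QuantumFields.YangMills.Theorems.FemtoTransferGap
open Summit.QuantumFields.YangMills.Theorems.FemtoTransferGap.TwoLattice.SlowChart

variable (L : ℕ) [NeZero L]

/-! ## §1 The gnomonic tube -/

/-- The gnomonic tube chart on the balanced subtype. [folklore] -/
def tubeChart (u : GaugeConfig 3 1 SU2) (y : balancedSet L) : GaugeConfig 3 L SU2 := tubeMap L u (y : Edge 3 L → Fin 3 → ℝ)

/-- The gnomonic tube chart is jointly continuous. [folklore] -/
theorem continuous_tubeChart : Continuous fun p : GaugeConfig 3 1 SU2 × balancedSet L => tubeChart L p.1 p.2 :=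
  (continuous_tubeMap L).comp (continuous_fst.prodMk (continuous_subtype_val.comp continuous_snd))

/-- The gnomonic tube chart is injective (★★ `tubeMap_injective`). [folklore] -/
theorem tubeChart_injective : Function.Injective fun p : GaugeConfig 3 1 SU2 × balancedSet L => tubeChart L p.1 p.2 := by
  intro p q h
  obtain ⟨hu, hy⟩ := tubeMap_injective L p.2.2 q.2.2 h
  exact Prod.ext hu (Subtype.ext hy)

/-- The gnomonic tube chart is equivariant. [folklore] -/
theorem tubeChart_mul (u v : GaugeConfig 3 1 SU2) (y : balancedSet L) : tubeChart L (u * v) y = tubeChart L u y * constLift L v :=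
  tubeMap_mul L u v y

/-- **The constant-mode tube** (gnomonic): the image of `tubeMap` on balanced coordinates. [folklore] -/
def constTube : Set (GaugeConfig 3 L SU2) := {U | ∃ u : GaugeConfig 3 1 SU2, ∃ y ∈ balancedSet L, tubeMap L u y = U}

/-- Points of the tube. [folklore] -/
theorem tubeMap_mem_constTube (u : GaugeConfig 3 1 SU2) {y : Edge 3 L → Fin 3 → ℝ} (hy : y ∈ balancedSet L) : tubeMap L u y ∈ constTube L :=
  ⟨u, y, hy, rfl⟩

/-- The tube is the range of the chart. [folklore] -/
theorem range_tubeChart : Set.range (fun p : GaugeConfig 3 1 SU2 × balancedSet L => tubeChart L p.1 p.2) = constTube L := by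
  ext U
  constructor
  · rintro ⟨p, rfl⟩; exact ⟨p.1, p.2, p.2.2, rfl⟩
  · rintro ⟨u, y, hy, rfl⟩; exact ⟨(u, ⟨y, hy⟩), rfl⟩

/-- The tube is measurable. [folklore] -/
theorem measurableSet_constTube : MeasurableSet (constTube L) := by
  haveI : PolishSpace (balancedSet L) := (isClosed_balancedSet L).polishSpace
  rw [← range_tubeChart]
  exact measurableSet_range_chart (continuous_tubeChart L) (tubeChart_injective L)

/-- **The transverse measure of the gnomonic tube** on `Edge → ℝ³` (carried by the balanced subspace). [folklore] -/
def tubeTransverse : Measure (Edge 3 L → Fin 3 → ℝ) := (slowMarginal (tubeChart L)).map Subtype.val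

/-- The transverse measure is finite. [folklore] -/
theorem isFiniteMeasure_tubeTransverse : IsFiniteMeasure (tubeTransverse L) := by
  haveI : PolishSpace (balancedSet L) := (isClosed_balancedSet L).polishSpace
  haveI := isFiniteMeasure_slowMarginal (continuous_tubeChart L) (tubeChart_injective L)
  unfold tubeTransverse; infer_instance

/-- The transverse measure is carried by the balanced subspace. [folklore] -/
theorem tubeTransverse_compl_balancedSet : tubeTransverse L (balancedSet L)ᶜ = 0 := by
  rw [tubeTransverse, Measure.map_apply measurable_subtype_coe (measurableSet_balancedSet L).compl]
  have h : (Subtype.val : balancedSet L → Edge 3 L → Fin 3 → ℝ) ⁻¹' (balancedSet L)ᶜ = ∅ := by ext y; simp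
  rw [h, measure_empty]

/-- ★★★ **EXACT ONE-SITE DISINTEGRATION ON THE GNOMONIC TUBE**: for bounded measurable `F` vanishing off `constTube L`,
`∫ F dσ^{⊗E} = ∫ (∫ F(tubeMap L u y) dσ^{⊗3}(u)) d(tubeTransverse L)(y)`. [cite: Luscher1983, §3] -/
theorem integral_configMeasure_tube {F : GaugeConfig 3 L SU2 → ℝ} (hF : Measurable F) (hb : ∃ C : ℝ, ∀ U, |F U| ≤ C)
    (h0 : ∀ U, U ∉ constTube L → F U = 0) :
    ∫ U, F U ∂configMeasure SU2 L = ∫ y, ∫ u, F (tubeMap L u y) ∂configMeasure SU2 1 ∂tubeTransverse L := by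
  haveI : PolishSpace (balancedSet L) := (isClosed_balancedSet L).polishSpace
  have h0' : ∀ U, U ∉ Set.range (fun p : GaugeConfig 3 1 SU2 × balancedSet L => tubeChart L p.1 p.2) → F U = 0 := by
    rw [range_tubeChart]; exact h0
  rw [integral_configMeasure_slowChart (continuous_tubeChart L) (tubeChart_injective L) (tubeChart_mul L) hF hb h0', tubeTransverse,
    (MeasurableEmbedding.subtype_coe (measurableSet_balancedSet L)).integral_map]
  rfl

/-! ## §2 The orthographic tube -/

/-- The orthographic tube chart on the capped balanced subtype. [folklore] -/
def orthoChart (u : GaugeConfig 3 1 SU2) (v : capBalancedSet L) : GaugeConfig 3 L SU2 := orthoTube L u (v : Edge 3 L → Fin 3 → ℝ)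

/-- The orthographic tube chart is jointly continuous. [folklore] -/
theorem continuous_orthoChart : Continuous fun p : GaugeConfig 3 1 SU2 × capBalancedSet L => orthoChart L p.1 p.2 := by
  have h1 : Continuous fun p : GaugeConfig 3 1 SU2 × capBalancedSet L => (p.1, (p.2 : Edge 3 L → Fin 3 → ℝ)) :=
    continuous_fst.prodMk (continuous_subtype_val.comp continuous_snd)
  have h2 := (continuous_orthoTube L).comp h1
  simpa only [orthoChart, Function.comp_def] using h2

/-- The orthographic tube chart is injective (★★ `orthoTube_injective`). [folklore] -/
theorem orthoChart_injective : Function.Injective fun p : GaugeConfig 3 1 SU2 × capBalancedSet L => orthoChart L p.1 p.2 := by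
  intro p q h
  obtain ⟨hu, hv⟩ := orthoTube_injective L p.2.2 q.2.2 h
  exact Prod.ext hu (Subtype.ext hv)

/-- The orthographic tube chart is equivariant. [folklore] -/
theorem orthoChart_mul (u w : GaugeConfig 3 1 SU2) (v : capBalancedSet L) : orthoChart L (u * w) v = orthoChart L u v * constLift L w :=
  orthoTube_mul L u w v

/-- The orthographic tube is the range of the chart. [folklore] -/
theorem range_orthoChart : Set.range (fun p : GaugeConfig 3 1 SU2 × capBalancedSet L => orthoChart L p.1 p.2) = orthoTubeSet L := by
  ext U
  constructor
  · rintro ⟨p, rfl⟩; exact ⟨p.1, p.2, p.2.2, rfl⟩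
  · rintro ⟨u, v, hv, rfl⟩; exact ⟨(u, ⟨v, hv⟩), rfl⟩

/-- The orthographic tube is measurable. [folklore] -/
theorem measurableSet_orthoTubeSet : MeasurableSet (orthoTubeSet L) := by
  haveI : PolishSpace (capBalancedSet L) := (isClosed_capBalancedSet L).polishSpace
  rw [← range_orthoChart]
  exact measurableSet_range_chart (continuous_orthoChart L) (orthoChart_injective L)

/-- **The transverse measure of the orthographic tube** on `Edge → ℝ³` (carried by the capped balanced set). [folklore] -/
def orthoTransverse : Measure (Edge 3 L → Fin 3 → ℝ) := (slowMarginal (orthoChart L)).map Subtype.val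

/-- The transverse measure is finite. [folklore] -/
theorem isFiniteMeasure_orthoTransverse : IsFiniteMeasure (orthoTransverse L) := by
  haveI : PolishSpace (capBalancedSet L) := (isClosed_capBalancedSet L).polishSpace
  haveI := isFiniteMeasure_slowMarginal (continuous_orthoChart L) (orthoChart_injective L)
  unfold orthoTransverse; infer_instance

/-- The transverse measure is carried by the capped balanced set. [folklore] -/
theorem orthoTransverse_compl_capBalancedSet : orthoTransverse L (capBalancedSet L)ᶜ = 0 := by
  rw [orthoTransverse, Measure.map_apply measurable_subtype_coe (measurableSet_capBalancedSet L).compl]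
  have h : (Subtype.val : capBalancedSet L → Edge 3 L → Fin 3 → ℝ) ⁻¹' (capBalancedSet L)ᶜ = ∅ := by ext v; simp
  rw [h, measure_empty]

/-- The total mass of the transverse measure is the a-priori measure of the tube. [folklore] -/
theorem orthoTransverse_univ : orthoTransverse L Set.univ = configMeasure SU2 L (orthoTubeSet L) := by
  haveI : PolishSpace (capBalancedSet L) := (isClosed_capBalancedSet L).polishSpace
  rw [orthoTransverse, Measure.map_apply measurable_subtype_coe MeasurableSet.univ, Set.preimage_univ,
    slowMarginal_univ (continuous_orthoChart L) (orthoChart_injective L), range_orthoChart]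

/-- ★★★ **EXACT ONE-SITE DISINTEGRATION ON THE ORTHOGRAPHIC TUBE**: for bounded measurable `F` vanishing off `orthoTubeSet L`,
`∫ F dσ^{⊗E} = ∫ (∫ F(orthoTube L u v) dσ^{⊗3}(u)) d(orthoTransverse L)(v)`. [cite: Luscher1983, §3] -/
theorem integral_configMeasure_orthoTube {F : GaugeConfig 3 L SU2 → ℝ} (hF : Measurable F) (hb : ∃ C : ℝ, ∀ U, |F U| ≤ C)
    (h0 : ∀ U, U ∉ orthoTubeSet L → F U = 0) :
    ∫ U, F U ∂configMeasure SU2 L = ∫ v, ∫ u, F (orthoTube L u v) ∂configMeasure SU2 1 ∂orthoTransverse L := by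
  haveI : PolishSpace (capBalancedSet L) := (isClosed_capBalancedSet L).polishSpace
  have h0' : ∀ U, U ∉ Set.range (fun p : GaugeConfig 3 1 SU2 × capBalancedSet L => orthoChart L p.1 p.2) → F U = 0 := by
    rw [range_orthoChart]; exact h0
  rw [integral_configMeasure_slowChart (continuous_orthoChart L) (orthoChart_injective L) (orthoChart_mul L) hF hb h0', orthoTransverse,
    (MeasurableEmbedding.subtype_coe (measurableSet_capBalancedSet L)).integral_map]
  rfl

/-- ★ **One-site functions on the tube integrate exactly**: for bounded measurable `F` vanishing off the tube and depending only on the slow variable along the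
tube (`F (orthoTube L u v) = f u`), `∫ F dσ^{⊗E} = (orthoTransverse L)(univ) · ∫ f dσ^{⊗3}` — e.g. the squared norm of a lifted one-site function. [folklore] -/
theorem integral_configMeasure_orthoTube_of_slow {F : GaugeConfig 3 L SU2 → ℝ} (hF : Measurable F) (hb : ∃ C : ℝ, ∀ U, |F U| ≤ C)
    (h0 : ∀ U, U ∉ orthoTubeSet L → F U = 0) {f : GaugeConfig 3 1 SU2 → ℝ}
    (hslow : ∀ (u : GaugeConfig 3 1 SU2) (v : Edge 3 L → Fin 3 → ℝ), v ∈ capBalancedSet L → F (orthoTube L u v) = f u) :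
    ∫ U, F U ∂configMeasure SU2 L = (orthoTransverse L Set.univ).toReal * ∫ u, f u ∂configMeasure SU2 1 := by
  haveI := isFiniteMeasure_orthoTransverse L
  rw [integral_configMeasure_orthoTube L hF hb h0]
  have hae : ∀ᵐ v ∂orthoTransverse L, v ∈ capBalancedSet L := by
    rw [ae_iff]
    have : {v : Edge 3 L → Fin 3 → ℝ | ¬v ∈ capBalancedSet L} = (capBalancedSet L)ᶜ := rfl
    rw [this]; exact orthoTransverse_compl_capBalancedSet L
  have h1 : ∫ v, ∫ u, F (orthoTube L u v) ∂configMeasure SU2 1 ∂orthoTransverse L = ∫ _v, ∫ u, f u ∂configMeasure SU2 1 ∂orthoTransverse L := by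
    refine integral_congr_ae (hae.mono fun v hv => ?_)
    dsimp only
    exact integral_congr_ae (ae_of_all _ fun u => hslow u v hv)
  rw [h1, integral_const, smul_eq_mul, Measure.real]

end Summit.QuantumFields.YangMills.Theorems.FemtoTransferGap.TwoLattice.ConstTube

end
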